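import Summits.ResolutionOfSingularities.ResolutionOfSingularities.Theorems.EquisingularLiftEquisingularLiftNatSubchainSupplierInvKDefs
import HarnessLib

/-!
# [OURS · L1 W4.5(b) · EL♮(3) · T23-A″-S] HSUB′(ReachTowerB″-S) — THE INNER-CHAIN INVARIANT WITH THE PLANE TRACE (definitions)
# `TCPlus.MemberS`, `TCPlus.InvS` = res-D-pv-029's `TCPlus.MemberKCL` / `TCPlus.InvKCL` (…NatSubchainSupplierInvKDefs, p570160) + clause
# (ix) «the Member's CARRIER `𝓢` has special fibre EXACTLY the downstairs plane: `𝓢.comap jG = 𝓘⟨closure S_d⟩`» + clause (x) «`V(𝓢) → Spec O` is FLAT»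

res-type-027 g18 (object «A″-S UPSTAIRS TWINS», res-L1-w45b-plan-1 desk RULING R20 (iv) 2026-08-28T08:09:27Z and DESK WORD 08:15:46Z;
specification = res-L1-w45b-stub-4's T23-A″ ENGINE WORD `L/res-L1-w45b-stub-4/T23Adprime-ENGINE-WORD.md` 16d03a46d50c8ccd §S (ii)).
Crux `EquisingularLiftNatThree` = stmt-ResolutionOfSingularities-20148 (parent `EquisingularLiftNat` = stmt-…-20038), route `EquisingularLift`,
line `sections`. OURS; NOT a statement of any manuscript ([Hironaka2017] is a candidate under adjudication, nothing of it is asserted);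
AI-written, weaker than expert review. Definitions + pure-logic projections only (no `sorry`, no instance, no notation; standard axioms).
`--supports stmt-ResolutionOfSingularities-20148 --as helper`.

WHY A SUCCESSOR PREDICATE (stub-4's memo §S). The boundary-witnessed («pair») rounds of the T23-A″ engine (`TowerRoundBDoublePrime`,
res-L1-w45b-lead-2 …NatTowerRoundBDoublePrimeDefs) blow up the reduced crossing curve of TWO retained members of the list `Es`; the customer
`x⁴ + y⁶ + z⁶` needs the strict transform `St(E_x)` of the FIRST exceptional plane `E_x = υ⁻¹{x}` to be such a member at the seed of the round
phase (`Es := [closure υ'⁻¹(S₉ ∖ Z₉)]` instead of `[]`). Upstairs the model of that plane EXISTS all along the inner chain: it is the Member's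
carrier `𝓢` (the exceptional divisor `(ker s)·𝒪_{X₁}` of the section blow-up at the base, then its strict transforms; regular, locally
principal), but `TCPlus.MemberKCL` records only the trace of the PAIR, (i) `(𝓢 ⊔ K).comap jG = 𝓘⟨closure Z⟩` — not the trace of `𝓢`
alone. Conjunct (ix) `𝓢.comap jG = 𝓘⟨closure S_d⟩` is that trace, and (x) `Flat (𝓢.subschemeι ≫ σ ≫ q)` is the `O`-flatness of the plane's
model ON ITS OWN ((ii) is about the pair) — the `FE` datum of the seeded member (`Tower.Exc₃`'s `Ruled := FE`), requested by the engine owner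
(res-L1-w45b-stub-4 SHAPE WORD 2026-08-28T08:22:44Z: born free at the base by `flat_exceptional_of_isBlowup_regularCentre`, transported free by
res-L1-w45b-stub-2's `flat_strictTransform_subschemeι_comp_stage`); `S_d` is the new fifth downstairs component (seed `υ⁻¹{x}`, point steps
`S_d ↦ closure υ₁⁻¹(S_d ∖ {y})` — the (A″-S)(i) downstairs vocabulary is res-L1-w45b-lead-2's, typed separately). As for `MemberK`
(res-D-pv-029's remark there), the clause cannot be bolted on from outside because `Member` hides `(X, σ, S, jG, tG, 𝓢, K)` behind `∃`:
`TCPlus.MemberS … G T Z K_d S_d excl` below = body of `MemberKCL` VERBATIM ∧ (ix) ∧ (x); `TCPlus.InvS` = `InvKCL` with `MemberS` in both member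
clauses and `S_d` threaded. The closure in (ix) matches (i) and (vii-loc) (`closure Z`, `closure K_d`): along the chain `S_d` IS closed, and
the predicate stays total without an `IsClosed` argument.

TRANSPORT OF (ix) (the `…S` twins of the inner bricks, res-type-027, separate files): through BOTH point steps by res-L1-w45b-stub-1's F⁺5
`comap_strictTransformIdeal_eq_of_model` (…NatStrictTransformComap p519966) for `𝓢` ALONE with the LINEAR form `T₀` — at a regular point the
`e𝓢` line of K7c `comap_strictTransformIdeal_carrierPair_eq_sup` (p533779), at a centred point the `e𝓢` line of
`comap_strictTransformIdeal_carrierPair_eq_sup_of_conePack` (p543070; the package frame has `𝓢_p = (c₀)`) — followed by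
res-L1-w45b-stub-4's `strictTransformIdeal_vanishingIdeal_eq` (p531318); at the base by `hcarrier` + res-L1-w45b-lead-1's LOCAL
reduced-exceptional-plane lemma; through the carrier-curve blow-up by res-D-pv-051's `coneRound_exceptional_comap 𝓢 K` (…NatConeRoundTransport
p549332), whose Cartier hypothesis `IsEffectiveCartier (K.comap 𝓢.subschemeι)` is (viii) swapped (`isEffectiveCartier_comap_subschemeι_swap`).
`memberS_memberKCL` / `invS_invKCL` recover the S-free predicates, so every KCL consumer applies unchanged.
-/

set_option linter.dupNamespace false -- mandated namespace `Summit.<Summit>.<Problem>` of this single-conjunct summit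
set_option linter.overlappingInstances false -- signatures carry `[IsDomain O] [IsDiscreteValuationRing O]`

noncomputable section

open CategoryTheory CategoryTheory.Limits AlgebraicGeometry TopologicalSpace Topology IsLocalRing
open Literature.AlgebraicGeometry.Resolution
open AlgebraicGeometry.Scheme.IdealSheafData

namespace Summit.ResolutionOfSingularities.ResolutionOfSingularities.Cruxes.EquisingularLiftNat.Sections.TCPlus

variable (O : Type) [CommRing O] [IsDomain O] [IsDiscreteValuationRing O] (k : Type) [Field k] (θ : O →+* k)
  (P : Scheme.{0}) (q : P ⟶ Spec (.of O)) (Y : Set P) (Ch : ∀ X' : Scheme.{0}, (X' ⟶ P) → Set X' → Prop)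

/-- **`TCPlus.MemberS` — a member carrying the localized cone shadow, the Cartier clause AND THE PLANE TRACE**: `TCPlus.MemberKCL O k θ P q Y
Ch G T Z K_d excl` (clauses (i)–(vi), (vii-loc), (viii) VERBATIM, see …NatSubchainSupplierInvKDefs) whose carrier `𝓢` has, in addition,
(ix) special fibre EXACTLY the reduced closed subscheme on the downstairs plane `closure S_d`: `𝓢.comap jG = 𝓘⟨closure S_d⟩`, and
(x) an `O`-FLAT zero locus: `Flat (𝓢.subschemeι ≫ σ ≫ q)`. [OURS · L1 W4.5b · T23-A″-S] -/
def MemberS (G : Scheme.{0}) (T Z Kd Sd : Set G) (excl : Set G) : Prop :=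
  ∃ (X : Scheme.{0}) (σ : X ⟶ P) (S : Set X) (jG : G ⟶ X) (tG : G ⟶ Spec (.of k)) (𝓢 K : X.IdealSheafData),
    Ch X σ S ∧ IsIntegral X ∧ IsLocallyNoetherian X ∧ Scheme.IsRegular X ∧ IsDominant (σ ≫ q) ∧
    IsPullback jG tG (σ ≫ q) (Spec.map (CommRingCat.ofHom θ)) ∧ jG '' T = S ∧
    -- (i) exact special fibre
    (𝓢 ⊔ K).comap jG = vanishingIdeal (⟨closure Z, isClosed_closure⟩ : Closeds G) ∧
    -- (ii) flat over `O`
    Flat ((𝓢 ⊔ K).subschemeι ≫ σ ≫ q) ∧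
    -- (iii) the carrier is regular, both ideal sheaves are locally principal
    Scheme.IsRegular 𝓢.subscheme ∧ (∀ z : X, (stalkIdeal 𝓢 z).IsPrincipal ∧ (stalkIdeal K z).IsPrincipal) ∧
    -- (iv) off the generic point of `Y`
    σ '' ((𝓢 ⊔ K).support : Set X) ⊆ {y : P | ¬ IsGenericPoint y Y} ∧
    -- (v) regular quotient stalks at the special points, off the excluded ones — of codimension `2` at the closed ones
    (∀ z ∈ ((𝓢 ⊔ K).support : Set X), (σ ≫ q) z = closedPoint O → z ∉ jG '' excl →
      IsRegularLocalRing (X.presheaf.stalk z ⧸ stalkIdeal (𝓢 ⊔ K) z) ∧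
      (IsClosed ({z} : Set X) →
        ringKrullDim (X.presheaf.stalk z ⧸ stalkIdeal (𝓢 ⊔ K) z) + 2 = ringKrullDim (X.presheaf.stalk z))) ∧
    -- (vi) centred packages at the excluded points
    (∀ y₀ ∈ excl, CentredPackage O P q X σ 𝓢 K (jG y₀)) ∧
    -- (vii-loc) the cone's special fibre is the downstairs shadow NEAR THE CARRIER CURVE (on an open neighbourhood of `Z`)
    (∃ V : G.Opens, Z ⊆ (V : Set G) ∧
      (K.comap jG).comap V.ι = (vanishingIdeal (⟨closure Kd, isClosed_closure⟩ : Closeds G)).comap V.ι) ∧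
    -- (viii) the carrier cuts an effective Cartier divisor on the cone
    IsEffectiveCartier (𝓢.comap K.subschemeι) ∧
    -- (ix) THE PLANE TRACE: the carrier's special fibre is the reduced downstairs plane
    𝓢.comap jG = vanishingIdeal (⟨closure Sd, isClosed_closure⟩ : Closeds G) ∧
    -- (x) the plane's model is flat over `O` ON ITS OWN (the seeded member's `FE` datum; res-L1-w45b-stub-4 SHAPE WORD 2026-08-28T08:22:44Z)
    Flat (𝓢.subschemeι ≫ σ ≫ q)

/-- **`TCPlus.InvS` — the inner invariant with localized shadow, Cartier clause and plane trace, `INV W G β T Z K_d S_d b`**: `TCPlus.InvKCL`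
with `MemberS` in both member clauses (the uncentred member and, while `b = false`, the centred member at every closed non-regular point of
`V(closure Z)_red`), the plane `S_d` threaded. [OURS · L1 W4.5b · T23-A″-S] -/
def InvS {F₁ F₂ : Scheme.{0}} (_W : Set F₁) (G : Scheme.{0}) (_β : G ⟶ F₂) (T Z Kd Sd : Set G) (b : Bool) : Prop :=
  IsIntegral G ∧ IsClosed T ∧ IsIrreducible T ∧ ¬ T ⊆ closure Z ∧ MemberS O k θ P q Y Ch G T Z Kd Sd ∅ ∧
    (b = false → ∀ y : ↥(vanishingIdeal (⟨closure Z, isClosed_closure⟩ : Closeds G)).subscheme,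
      IsClosed ({((vanishingIdeal (⟨closure Z, isClosed_closure⟩ : Closeds G)).subschemeι y : G)} : Set G) →
      ¬ IsRegularLocalRing ((vanishingIdeal (⟨closure Z, isClosed_closure⟩ : Closeds G)).subscheme.presheaf.stalk y) →
      MemberS O k θ P q Y Ch G T Z Kd Sd {((vanishingIdeal (⟨closure Z, isClosed_closure⟩ : Closeds G)).subschemeι y : G)})

/-! ## Pure-logic projections -/

/-- `MemberS ⇒ MemberKCL` (forget the plane trace (ix)). [OURS · pure logic] -/
theorem memberS_memberKCL {G : Scheme.{0}} {T Z Kd Sd excl : Set G} (h : MemberS O k θ P q Y Ch G T Z Kd Sd excl) :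
    MemberKCL O k θ P q Y Ch G T Z Kd excl := by
  obtain ⟨X, σ, S, jG, tG, 𝓢, K, hCh, hXint, hXnoeth, hXreg, hdom, hsq, hTS, hi, hii, hiii, hiiip, hiv, hv, hvi, hvii, hviii, -, -⟩ := h
  exact ⟨X, σ, S, jG, tG, 𝓢, K, hCh, hXint, hXnoeth, hXreg, hdom, hsq, hTS, hi, hii, hiii, hiiip, hiv, hv, hvi, hvii, hviii⟩

/-- `MemberS ⇒ Member` (forget (vii-loc), (viii), (ix)). [OURS · pure logic] -/
theorem memberS_member {G : Scheme.{0}} {T Z Kd Sd excl : Set G} (h : MemberS O k θ P q Y Ch G T Z Kd Sd excl) :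
    Member O k θ P q Y Ch G T Z excl :=
  memberKCL_member O k θ P q Y Ch (memberS_memberKCL O k θ P q Y Ch h)

/-- The plane-trace clause (ix) of a member, for the record: the carrier is an upstairs ideal sheaf, locally principal with REGULAR zero
locus, `O`-flat, whose special fibre is EXACTLY `𝓘⟨closure S_d⟩`, for SOME realisation. [OURS · pure logic] -/
theorem memberS_plane {G : Scheme.{0}} {T Z Kd Sd excl : Set G} (h : MemberS O k θ P q Y Ch G T Z Kd Sd excl) :
    ∃ (X : Scheme.{0}) (σ : X ⟶ P) (jG : G ⟶ X) (tG : G ⟶ Spec (.of k)) (𝓢 : X.IdealSheafData),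
      IsPullback jG tG (σ ≫ q) (Spec.map (CommRingCat.ofHom θ)) ∧ (∀ z : X, (stalkIdeal 𝓢 z).IsPrincipal) ∧
      Scheme.IsRegular 𝓢.subscheme ∧ 𝓢.comap jG = vanishingIdeal (⟨closure Sd, isClosed_closure⟩ : Closeds G) ∧
      Flat (𝓢.subschemeι ≫ σ ≫ q) := by
  obtain ⟨X, σ, S, jG, tG, 𝓢, K, -, -, -, -, -, hsq, -, -, -, hiii, hiiip, -, -, -, -, -, hix, hx⟩ := h
  exact ⟨X, σ, jG, tG, 𝓢, hsq, fun z => (hiiip z).1, hiii, hix, hx⟩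

/-- `InvS ⇒ InvKCL` (forget the plane). [OURS · pure logic] -/
theorem invS_invKCL {F₁ F₂ : Scheme.{0}} {W : Set F₁} {G : Scheme.{0}} {β : G ⟶ F₂} {T Z Kd Sd : Set G} {b : Bool}
    (h : InvS O k θ P q Y Ch W G β T Z Kd Sd b) : InvKCL O k θ P q Y Ch W G β T Z Kd b := by
  obtain ⟨hG, hT, hTirr, hTZ, hmem, hcen⟩ := h
  exact ⟨hG, hT, hTirr, hTZ, memberS_memberKCL O k θ P q Y Ch hmem,
    fun hb y hy hreg => memberS_memberKCL O k θ P q Y Ch (hcen hb y hy hreg)⟩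

/-- `InvS ⇒ Inv` (forget shadow, Cartier clause and plane: res-L1-w45b-stub-1's invariant). [OURS · pure logic] -/
theorem invS_inv {F₁ F₂ : Scheme.{0}} {W : Set F₁} {G : Scheme.{0}} {β : G ⟶ F₂} {T Z Kd Sd : Set G} {b : Bool}
    (h : InvS O k θ P q Y Ch W G β T Z Kd Sd b) : Inv O k θ P q Y Ch W G β T Z b :=
  invKCL_inv O k θ P q Y Ch (invS_invKCL O k θ P q Y Ch h)

/-- The uncentred member's plane trace, read off `InvS` (what the curve step of the B″-S tower consumes). [OURS · pure logic] -/
theorem invS_memberS {F₁ F₂ : Scheme.{0}} {W : Set F₁} {G : Scheme.{0}} {β : G ⟶ F₂} {T Z Kd Sd : Set G} {b : Bool}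
    (h : InvS O k θ P q Y Ch W G β T Z Kd Sd b) : MemberS O k θ P q Y Ch G T Z Kd Sd ∅ :=
  h.2.2.2.2.1

end Summit.ResolutionOfSingularities.ResolutionOfSingularities.Cruxes.EquisingularLiftNat.Sections.TCPlus

end
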